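import Literature.NumberTheory.EllipticCurves.Kato2004.EulerSystemValues
import HarnessLib

/-!
# `ZetaBody` TRANSFERS to a second value datum that is equivariant, local at `p`, and takes the same
# values on the classes (crux `KatoKuriharaPortThreeShared`, stmt-BirchSwinnertonDyer-19560; cell `bsd-addord`,
# seat w2-acc5 gen 5; route W2 `KimAtThreeKolyvagin`; `--supports 19560`, helper)

HONEST FRAMING.  ONE TOOL theorem (no definition, no named fact, no `sorry`); every `p`; closes nothing;
nothing is booked; BSD is not proved by any of this.

WHAT.  `Kato2004.ZetaBody W p f ι κ Λ c d a A z x` is the conjunction (C1) Euler system ∧ (C2) unramified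
away from `p` ∧ (C3a) `Λ` equivariant ∧ (C3b) `Λ` local at `p` ∧ (C4) `Λ(z) = 1 ⊗ x` ∧ (C5) value law for
`x`.  Clauses (C1), (C2), (C5) do not mention `Λ`.  Hence (`zetaBody_transfer`): if `ZetaBody` holds for
SOME value datum `Λ₁` (e.g. the abstract one of the tree's named fact
`Kato2004.exists_eulerSystem_expStar_values`, Kato 2004 Ex. 13.3 / Thm. 9.7 / Thm. 6.6) and `Λ₀` is a
second datum with (C3a), (C3b) and (C4) **for the same classes `z` and values `x`**, then `ZetaBody` holds
for `Λ₀` with the same `(κ, z, x)`.  For the DEFINED single-completion datum `Λ₀` of `hKatoV2₀`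
(kim3 p508902 / w2-acc5 p506982) the clauses (C3a)/(C3b) are kernel theorems modulo the LEAD's local
semilinearity (GAL_loc) (`KimAtThreeFineKatoValueEquivarianceBridge`, `…Local`), so the supplier of
`hKatoV2₀`'s `ZetaBody` conjunct owes, beyond the tree's Kato fact, exactly **(C4) for the defined `exp*`
on Kato's classes** — Kato's Thm. 9.7 read with `exp*` DEFINED (the honest content of «Kato-v2») — and
(GAL_loc).

References: K. Kato, Astérisque 295 (2004) (8.1.3), Prop. 8.12, §9.4, Thm. 9.7, Thm. 6.6 (1), Ex. 13.3
[Kato2004Asterisque]; K. Rubin, *Euler Systems* (2000) Def. 2.1.1 [Rubin2000].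
-/

noncomputable section

-- the cell's Theorems namespace `Summit.BirchSwinnertonDyer.BirchSwinnertonDyer.…` repeats the summit name by design (D-0017)
set_option linter.dupNamespace false

open scoped NumberField TensorProduct Pointwise
open Field NumberField IsDedekindDomain
open Literature.NumberTheory.EllipticCurves Literature.NumberTheory.GaloisRepresentations
  Literature.NumberTheory.EllipticCurves.Kato2004 Literature.NumberTheory.EllipticCurves.Kato2004.EulerSystemValues
  Literature.NumberTheory.EllipticCurves.ModularForms

namespace Summit.BirchSwinnertonDyer.BirchSwinnertonDyer.Theorems.KimAtThreeFineKatoZetaBodyTransfer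

variable (W : WeierstrassCurve ℚ) [W.IsElliptic] (p : ℕ) [Fact p.Prime]
  [ContinuousSMul ℤ_[p] (W.tateModule p)] [Module.Free ℤ_[p] (W.tateModule p)]
  [Module.Finite ℤ_[p] (W.tateModule p)] {N : ℕ} (f : CuspForm (CongruenceSubgroup.Gamma0 N) 2)
  (ι : (m : ℕ) → (CyclotomicField m ℚ →+* ℂ)) (κ : ℝ)
  (Λ₁ Λ₀ : ∀ (k : ℕ) (r : Finset (HeightOneSpectrum (𝓞 ℚ))),
    H1 (tateRep W p) (cycSubgroup p k r) →ₗ[ℤ_[p]] ℚ_[p] ⊗[ℚ] CyclotomicField (cycLevel p k r) ℚ)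
  (c d a : ℤ) (A : ℕ)
  (z : ∀ (k : ℕ) (r : (cyclotomicLevelsRat p (badPlaces c d A N)).Ideals),
    H1 (tateRep W p) ((cyclotomicLevelsRat p (badPlaces c d A N)).level k r.1))
  (x : ∀ (k : ℕ) (r : (cyclotomicLevelsRat p (badPlaces c d A N)).Ideals),
    CyclotomicField (cycLevel p k r.1) ℚ)

/-- **`ZetaBody` transfers to a second value datum.**  If `ZetaBody W p f ι κ Λ₁ c d a A z x` holds and
`Λ₀` satisfies (C3a) `Gal(ℚ(μ_m)/ℚ)`-equivariance, (C3b) locality at `p`, and (C4) `Λ₀(z_{k,r}) = 1 ⊗ x_{k,r}`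
for the SAME classes and values, then `ZetaBody W p f ι κ Λ₀ c d a A z x` (clauses (C1), (C2), (C5) do not
mention the value datum).  The three hypotheses are the (C3a)/(C3b)/(C4) clauses of `ZetaBody` VERBATIM for
`Λ₀`. [cite: Kato2004Asterisque, (8.1.3) (p. 180), Prop. 8.12 (p. 186), §9.4 and Thm. 9.7 (pp. 188–189), Thm. 6.6 (1) (p. 163), Ex. 13.3 (pp. 224–225)]
[cite: Rubin2000, Def. 2.1.1 and Remark 2.1.4] -/
theorem zetaBody_transfer (h : ZetaBody W p f ι κ Λ₁ c d a A z x)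
    (hC3a : ∀ (k : ℕ) (r : Finset (HeightOneSpectrum (𝓞 ℚ))) (σ : absoluteGaloisGroup ℚ)
        (y : H1 (tateRep W p) (cycSubgroup p k r)),
      Λ₀ k r (conjMap (tateRep W p).toTopRep (cycSubgroup p k r) σ 1 y) =
        Algebra.TensorProduct.map (AlgHom.id ℚ ℚ_[p])
          (sigma (cycLevel p k r) (modNCyclotomicCharacter ℚ (cycLevel p k r) σ) :
            CyclotomicField (cycLevel p k r) ℚ →ₐ[ℚ] CyclotomicField (cycLevel p k r) ℚ)
          (Λ₀ k r y))
    (hC3b : ∀ (k : ℕ) (r : Finset (HeightOneSpectrum (𝓞 ℚ))) (y : H1 (tateRep W p) (cycSubgroup p k r)),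
      (∀ v : HeightOneSpectrum (𝓞 ℚ), ((Rat.HeightOneSpectrum.primesEquiv v : Nat.Primes) : ℕ) = p →
        ∀ 𝔓 ∈ v.primesAbove,
          resLe (tateRep W p).toTopRep
              (inf_le_left : cycSubgroup p k r ⊓ MulAction.stabilizer (absoluteGaloisGroup ℚ) 𝔓 ≤
                cycSubgroup p k r)
              1 y = 0) →
      Λ₀ k r y = 0)
    (hC4 : ∀ (k : ℕ) (r : (cyclotomicLevelsRat p (badPlaces c d A N)).Ideals),
      Λ₀ k r.1 (z k r) = (1 : ℚ_[p]) ⊗ₜ[ℚ] x k r) :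
    ZetaBody W p f ι κ Λ₀ c d a A z x := by
  obtain ⟨h1, h2, -, -, -, h5⟩ := h
  exact ⟨h1, h2, hC3a, hC3b, hC4, h5⟩

end Summit.BirchSwinnertonDyer.BirchSwinnertonDyer.Theorems.KimAtThreeFineKatoZetaBodyTransfer

end
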